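import Literature.AlgebraicGeometry.Resolution.QuadraticTransformsFactorization
import HarnessLib

/-!
# The structure of a quadratic transform: charts, chart change, and the dichotomy

Topic: `Literature/AlgebraicGeometry/Resolution`. Complements to the quadratic-transform theory
of `QuadraticTransforms*.lean` (Cutkosky 2014, §2.1; Huneke–Swanson 2006, §14.2 and proof of
Thm. 14.5.2; Zariski–Samuel II, App. 5) needed for Zariski's count of base points
(`QuadraticTransformsTree.lean`): let `R₁ = R[𝔪_R/x]_𝔫` be a quadratic transform of the local
ring `R ⊆ K` (`IsQuadraticTransform R R₁`). PROVED:

* `IsQuadraticTransform.eq_ofPrime` — **chart change**: for ANY non-zero `x' ∈ 𝔪_R` with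
  `R[𝔪_R/x'] ⊆ R₁`, `R₁` is the local ring `R[𝔪_R/x']_{𝔪_{R₁} ∩ R[𝔪_R/x']}` (Mathlib
  `LocalSubring.ofPrime`, so `IsLocalization.AtPrime` is available);
* `IsQuadraticTransform.blowupRing_le_or` — for `𝔪_R = (u, v)`, `R₁` contains `R[𝔪_R/u]` or
  `R[𝔪_R/v]` (one of `u/x`, `v/x` is a unit of `R₁`);
* `IsQuadraticTransform.chart_not_mem_sq` — the element `x` of a quadratic transform lies in
  `𝔪_R ∖ 𝔪_R²` (else `1 ∈ 𝔪_R R₁`);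
* `IsQuadraticTransform.sub_mem_maximalIdeal_of_not_le` — for `𝔪_R = (u, v)`: at most one
  residue class `t mod 𝔪_R` has `R[𝔪_R/(u + tv)] ⊄ R₁` (the charts missing the point `R₁`);
* `IsQuadraticTransform.mem_or_inv_mem_or_isRegularLocalRing` — **dichotomy** for `R` regular of
  dimension two with `K = Frac R`: `R₁` is either a valuation ring of `K` (the local ring of the
  exceptional curve) or again a two-dimensional regular local ring of `K` (Huneke–Swanson, proof
  of Thm. 14.5.2: "If `𝔪₁` has height 1, then `R₁` is a Noetherian discrete valuation ring …
  So necessarily `R₁` is again a two-dimensional regular local ring"), with `Frac R₁ = K`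
  (`isLocalRingOf_of_le`).

## References

* S. D. Cutkosky, Math. Ann. 362 (2015) (arXiv:1404.7459), §2.1. [Cutkosky2014]
* C. Huneke, I. Swanson, *Integral Closure of Ideals, Rings, and Modules* (2006), §14.2 and
  Thm. 14.5.2 (proof). [HunekeSwanson2006]
* O. Zariski, P. Samuel, *Commutative Algebra* II (1960), Appendix 5. [ZariskiSamuel1960]
-/

noncomputable section

open IsLocalRing Polynomial

namespace Literature.AlgebraicGeometry.Resolution

universe u

variable {K : Type u} [Field K]

/-! ## Fraction fields persist -/

/-- A local subring containing a local ring of `K` (with `Frac = K`) is a local ring of `K`.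
[folklore] -/
theorem isLocalRingOf_of_le {R S : Subring K} (hR : IsLocalRingOf R) (hle : R ≤ S)
    [IsLocalRing S] : IsLocalRingOf S :=
  ⟨‹_›, fun z => by
    obtain ⟨a, ha, b, hb, hb0, rfl⟩ := hR.2 z
    exact ⟨a, hle ha, b, hle hb, hb0, rfl⟩⟩

/-- The target of a quadratic transform of a local ring of `K` is a local ring of `K`.
[cite: Cutkosky2014, §2.1] -/
theorem IsQuadraticTransform.isLocalRingOf {R R₁ : Subring K} (h : IsQuadraticTransform R R₁)
    (hR : IsLocalRingOf R) : IsLocalRingOf R₁ :=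
  haveI := h.isLocalRing
  isLocalRingOf_of_le hR h.dominates.1

/-- In a subring of a field, an element with inverse in the subring and non-zero is not in a
proper ideal… concretely: a unit of a local subring is outside the maximal ideal. [folklore] -/
theorem not_mem_maximalIdeal_of_inv_mem {S : Subring K} [IsLocalRing S] {z : S} (hz0 : (z : K) ≠ 0)
    (hzi : (z : K)⁻¹ ∈ S) : z ∉ maximalIdeal S := by
  rw [mem_maximalIdeal_iff_inv_not_mem]
  push Not
  exact ⟨hz0, hzi⟩

/-! ## Chart change -/

section Chart

variable {R R₁ : Subring K}

/-- For `A' ⊆ R₁`: elements of `A'` outside the contraction of `𝔪_{R₁}` are invertible in `R₁`.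
[folklore] -/
theorem inv_mem_of_not_mem_comap [IsLocalRing R₁] {A' : Subring K}
    (hle : A' ≤ R₁) {s : A'}
    (hs : s ∉ (maximalIdeal R₁).comap (Subring.inclusion hle)) : ((s : _) : K)⁻¹ ∈ R₁ := by
  rw [Ideal.mem_comap, IsLocalRing.notMem_maximalIdeal, isUnit_subring_iff_inv_mem,
    Subring.coe_inclusion] at hs
  exact hs.2

/-- Conversely a non-zero element of `A'` invertible in `R₁` lies outside the contraction of
`𝔪_{R₁}`. [folklore] -/
theorem not_mem_comap_of_inv_mem [IsLocalRing R₁] {A' : Subring K}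
    (hle : A' ≤ R₁) {s : A'} (hs0 : ((s : _) : K) ≠ 0)
    (hsi : ((s : _) : K)⁻¹ ∈ R₁) : s ∉ (maximalIdeal R₁).comap (Subring.inclusion hle) := by
  rw [Ideal.mem_comap]
  exact not_mem_maximalIdeal_of_inv_mem (S := R₁) (z := Subring.inclusion hle s) hs0 hsi

/-- **Chart change for a quadratic transform**: if `R₁` is a quadratic transform of `R` and
`x' ∈ 𝔪_R` is any non-zero element with `R[𝔪_R/x'] ⊆ A' ⊆ R₁` for a subring `A'` (e.g.
`A' = R[𝔪_R/x']`, or `A' = R[y/x']` when `𝔪_R = (x', y)`), then `R₁` is the localisation of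
`A'` at the contraction of `𝔪_{R₁}` — as a subring of `K`, `R₁ = LocalSubring.ofPrime A' (𝔪_{R₁} ∩ A')`.
(With the `x` of the definition: `x/x'` is a unit of `R₁`, so `R[𝔪_R/x] ⊆ A'_{𝔫'}`, and unit
denominators stay units.) [cite: HunekeSwanson2006, §14.2 (p. 264)] -/
theorem IsQuadraticTransform.eq_ofPrime_of_le [IsLocalRing R] [IsLocalRing R₁]
    (h : IsQuadraticTransform R R₁) {x' : R} (hx' : x' ∈ maximalIdeal R) (hx'0 : x' ≠ 0)
    {A' : Subring K} (hA' : blowupRing R (x' : K) ≤ A') (hle : A' ≤ R₁) :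
    R₁ = (LocalSubring.ofPrime A' ((maximalIdeal R₁).comap (Subring.inclusion hle))).toSubring := by
  obtain ⟨_, x, hx, hx0, _, hT, hfrac, -⟩ := h
  set 𝔫' : Ideal A' := (maximalIdeal R₁).comap (Subring.inclusion hle) with h𝔫'
  have hx0K : ((x : R) : K) ≠ 0 := fun e => hx0 (Subtype.ext e)
  have hx'0K : ((x' : R) : K) ≠ 0 := fun e => hx'0 (Subtype.ext e)
  apply le_antisymm
  · -- `R₁ ⊆ A'_{𝔫'}`: first `R[𝔪/x] ⊆ A'_{𝔫'}`
    have hxx' : ((x : R) : K) / x' ∈ A' := hA' (div_mem_blowupRing _ hx)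
    have hxx'0 : ((⟨_, hxx'⟩ : A') : K) ≠ 0 := div_ne_zero hx0K hx'0K
    have hxx'inv : (((x : R) : K) / x')⁻¹ ∈ R₁ := by
      rw [inv_div]; exact hT (div_mem_blowupRing _ hx')
    have hxx'n : (⟨_, hxx'⟩ : A') ∉ 𝔫' := not_mem_comap_of_inv_mem hle hxx'0 hxx'inv
    have hAle : blowupRing R (x : K) ≤ (LocalSubring.ofPrime A' 𝔫').toSubring := by
      refine Subring.closure_le.mpr ?_
      rintro z (hz | ⟨y, hy, rfl⟩)
      · exact LocalSubring.le_ofPrime A' 𝔫' (hA' (le_blowupRing R (x' : K) hz))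
      · -- `y/x = (y/x') · (x/x')⁻¹`
        have e : ((y : R) : K) / x = (y : K) / x' * (((x : R) : K) / x')⁻¹ := by
          field_simp
        show ((y : R) : K) / x ∈ _
        rw [e]
        exact Subring.mul_mem _ (LocalSubring.le_ofPrime A' 𝔫' (hA' (div_mem_blowupRing _ hy)))
          (inv_mem_ofPrime hxx'n)
    intro z hz
    obtain ⟨a, ha, b, hb, hbinv, rfl⟩ := hfrac z hz
    by_cases hb0 : b = 0
    · rw [hb0, div_zero]; exact Subring.zero_mem _
    rw [div_eq_mul_inv]
    refine Subring.mul_mem _ (hAle ha) ?_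
    -- `b ∈ A ⊆ A'_{𝔫'}` is a unit of `R₁`; write `b = a₂/s₂` and invert
    obtain ⟨a₂, s₂, hs₂, hbe⟩ := mem_ofPrime_iff.mp (hAle hb)
    have hs₂0 : ((s₂ : A') : K) ≠ 0 := coe_ne_zero_of_not_mem (K := K) hs₂
    have ha₂0 : ((a₂ : A') : K) ≠ 0 := by
      intro e
      rw [e, zero_div] at hbe
      exact hb0 hbe
    have ha₂inv : ((a₂ : A') : K)⁻¹ ∈ R₁ := by
      -- `a₂ = b s₂`, so `a₂⁻¹ = b⁻¹ s₂⁻¹`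
      have e : ((a₂ : A') : K)⁻¹ = b⁻¹ * ((s₂ : A') : K)⁻¹ := by
        rw [hbe]; field_simp
      rw [e]
      exact R₁.mul_mem hbinv (inv_mem_of_not_mem_comap hle hs₂)
    have ha₂n : a₂ ∉ 𝔫' := not_mem_comap_of_inv_mem hle ha₂0 ha₂inv
    rw [hbe, inv_div]
    exact div_mem_ofPrime s₂ ha₂n
  · exact ofPrime_le hle fun s hs => inv_mem_of_not_mem_comap hle hs

/-- **Chart change**, the case `A' = R[𝔪_R/x']`: `R₁ = R[𝔪_R/x']_{𝔪_{R₁} ∩ R[𝔪_R/x']}` for every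
non-zero `x' ∈ 𝔪_R` with `R[𝔪_R/x'] ⊆ R₁`. [cite: HunekeSwanson2006, §14.2 (p. 264)] -/
theorem IsQuadraticTransform.eq_ofPrime [IsLocalRing R] [IsLocalRing R₁]
    (h : IsQuadraticTransform R R₁) {x' : R} (hx' : x' ∈ maximalIdeal R) (hx'0 : x' ≠ 0)
    (hle : blowupRing R (x' : K) ≤ R₁) :
    R₁ = (LocalSubring.ofPrime (blowupRing R (x' : K))
      ((maximalIdeal R₁).comap (Subring.inclusion hle))).toSubring :=
  h.eq_ofPrime_of_le hx' hx'0 le_rfl hle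

end Chart

/-! ## Which charts contain the transform -/

section Charts

variable {R R₁ : Subring K}

/-- If `R[𝔪_R/x] ⊆ R₁` (`x ≠ 0`) and `x/u ∈ R₁`, then `R[𝔪_R/u] ⊆ R₁` (`y/u = (y/x)(x/u)`).
[folklore] -/
theorem blowupRing_le_of_div_mem [IsLocalRing R] {x u : K} (hx0 : x ≠ 0)
    (hT : blowupRing R x ≤ R₁) (hxu : x / u ∈ R₁) : blowupRing R u ≤ R₁ := by
  have hRle : R ≤ R₁ := (le_blowupRing R x).trans hT
  refine Subring.closure_le.mpr ?_
  rintro z (hz | ⟨y, hy, rfl⟩)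
  · exact hRle hz
  · change ((y : R) : K) / u ∈ R₁
    by_cases hu0 : u = 0
    · rw [hu0, div_zero]; exact R₁.zero_mem
    have e : ((y : R) : K) / u = (y : K) / x * (x / u) := by field_simp
    rw [e]
    exact R₁.mul_mem (hT (div_mem_blowupRing _ hy)) hxu

/-- **A quadratic transform lies in one of the two standard charts**: if `𝔪_R = (u, v)` then
`R[𝔪_R/u] ⊆ R₁` or `R[𝔪_R/v] ⊆ R₁` — writing the chart element `x = αu + βv`,
`1 = α(u/x) + β(v/x)` in the local ring `R₁`, so `u/x` or `v/x` is a unit of `R₁`.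
[cite: HunekeSwanson2006, §14.2 (p. 264)] -/
theorem IsQuadraticTransform.blowupRing_le_or [IsLocalRing R] (h : IsQuadraticTransform R R₁)
    {u v : R} (huv : maximalIdeal R = Ideal.span {u, v}) :
    blowupRing R (u : K) ≤ R₁ ∨ blowupRing R (v : K) ≤ R₁ := by
  obtain ⟨_, x, hx, hx0, hloc, hT, -, hdom⟩ := h
  haveI := hloc
  have hx0K : ((x : R) : K) ≠ 0 := fun e => hx0 (Subtype.ext e)
  have hRle : R ≤ R₁ := (le_blowupRing R (x : K)).trans hT
  rw [huv, Ideal.mem_span_pair] at hx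
  obtain ⟨α, β, hαβ⟩ := hx
  have hu : (u : K) / x ∈ R₁ := hT (div_mem_blowupRing _ (huv ▸ Ideal.subset_span (by simp)))
  have hv : (v : K) / x ∈ R₁ := hT (div_mem_blowupRing _ (huv ▸ Ideal.subset_span (by simp)))
  -- `1 = α (u/x) + β (v/x)` in `R₁`
  have hsum : (⟨α, hRle α.2⟩ : R₁) * ⟨_, hu⟩ + ⟨β, hRle β.2⟩ * ⟨_, hv⟩ = 1 := by
    apply Subtype.ext
    change (α : K) * ((u : K) / x) + (β : K) * ((v : K) / x) = 1
    have e := congrArg (fun r : R => (r : K)) hαβ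
    simp only [Subring.coe_add, Subring.coe_mul] at e
    field_simp
    linear_combination e
  -- so `u/x` or `v/x` is a unit of `R₁`
  have hunit : IsUnit (⟨_, hu⟩ : R₁) ∨ IsUnit (⟨_, hv⟩ : R₁) := by
    by_contra hcon
    push Not at hcon
    have h1 : (⟨α, hRle α.2⟩ : R₁) * ⟨_, hu⟩ + ⟨β, hRle β.2⟩ * ⟨_, hv⟩ ∈ maximalIdeal R₁ :=
      Ideal.add_mem _ (Ideal.mul_mem_left _ _ ((mem_maximalIdeal _).mpr hcon.1))
        (Ideal.mul_mem_left _ _ ((mem_maximalIdeal _).mpr hcon.2))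
    rw [hsum] at h1
    exact (maximalIdeal.isMaximal R₁).ne_top (Ideal.eq_top_of_isUnit_mem _ h1 isUnit_one)
  rcases hunit with hU | hV
  · left
    obtain ⟨-, hinv⟩ := (isUnit_subring_iff_inv_mem _).mp hU
    change (((u : R) : K) / x)⁻¹ ∈ R₁ at hinv
    rw [inv_div] at hinv
    exact blowupRing_le_of_div_mem hx0K hT hinv
  · right
    obtain ⟨-, hinv⟩ := (isUnit_subring_iff_inv_mem _).mp hV
    change (((v : R) : K) / x)⁻¹ ∈ R₁ at hinv
    rw [inv_div] at hinv
    exact blowupRing_le_of_div_mem hx0K hT hinv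

/-- **The chart element of a quadratic transform lies outside `𝔪_R²`**: if `x = Σ yᵢ zᵢ` with
`yᵢ, zᵢ ∈ 𝔪_R` then `1 = Σ (yᵢ/x) zᵢ ∈ 𝔪_R R₁ ⊆ 𝔪_{R₁}` by domination. [folklore] -/
theorem IsQuadraticTransform.chart_not_mem_sq [IsLocalRing R] [IsLocalRing R₁] {x : R}
    (hT : blowupRing R (x : K) ≤ R₁) (hdom : SubringDominates R R₁) (hx0 : x ≠ 0) :
    x ∉ maximalIdeal R ^ 2 := by
  intro hx2
  have hx0K : ((x : R) : K) ≠ 0 := fun e => hx0 (Subtype.ext e)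
  have hRle : R ≤ R₁ := hdom.1
  -- `C z`: `z/x` lies in `𝔪_{R₁}`
  let C : R → Prop := fun z => ∃ hz : (z : K) / x ∈ R₁, (⟨_, hz⟩ : R₁) ∈ maximalIdeal R₁
  have hadd : ∀ y z : R, C y → C z → C (y + z) := by
    rintro y z ⟨hy, hym⟩ ⟨hz, hzm⟩
    have hmem : ((y + z : R) : K) / x ∈ R₁ := by
      rw [Subring.coe_add, add_div]; exact R₁.add_mem hy hz
    refine ⟨hmem, ?_⟩
    have e : (⟨_, hmem⟩ : R₁) = ⟨_, hy⟩ + ⟨_, hz⟩ := Subtype.ext (by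
      change ((y + z : R) : K) / x = (y : K) / x + (z : K) / x
      rw [Subring.coe_add, add_div])
    rw [e]; exact Ideal.add_mem _ hym hzm
  have hmul : ∀ y ∈ maximalIdeal R, ∀ z ∈ maximalIdeal R, C (y • z) := by
    intro y hy z hz
    have hyx : (y : K) / x ∈ R₁ := hT (div_mem_blowupRing _ hy)
    have hmem : ((y • z : R) : K) / x ∈ R₁ := by
      rw [smul_eq_mul, Subring.coe_mul, mul_div_right_comm]
      exact R₁.mul_mem hyx (hRle z.2)
    refine ⟨hmem, ?_⟩
    have e : (⟨_, hmem⟩ : R₁) = ⟨_, hyx⟩ * Subring.inclusion hRle z := Subtype.ext (by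
      change ((y • z : R) : K) / x = (y : K) / x * (z : K)
      rw [smul_eq_mul, Subring.coe_mul, mul_div_right_comm])
    rw [e]
    exact Ideal.mul_mem_left _ _ ((incl_mem_maximalIdeal_iff hdom z).mpr hz)
  have hC : C x := by
    rw [pow_two] at hx2
    exact Submodule.smul_induction_on (p := C) hx2 hmul hadd
  obtain ⟨hz, hmem⟩ := hC
  have h1 : (⟨_, hz⟩ : R₁) = 1 := Subtype.ext (div_self hx0K)
  rw [h1] at hmem
  exact (maximalIdeal.isMaximal R₁).ne_top (Ideal.eq_top_of_isUnit_mem _ hmem isUnit_one)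

/-- **Charts missing the transform form at most one residue class**: for `𝔪_R = (u, v)` (not
principal) and a quadratic transform `R₁` of `R`, if neither `R[𝔪_R/(u + tv)]` nor
`R[𝔪_R/(u + t'v)]` is contained in `R₁` then `t ≡ t'` modulo `𝔪_R`: in the chart of `u`
(resp. `v`), `1 + t(v/u)` (resp. `u/v + t`) must be a non-unit of `R₁`, which pins down `t mod 𝔪`.
[cite: ZariskiSamuel1960, Appendix 5] -/
theorem IsQuadraticTransform.sub_mem_maximalIdeal_of_not_le [IsLocalRing R] [IsLocalRing R₁]
    (h : IsQuadraticTransform R R₁) {u v : R} (huv : maximalIdeal R = Ideal.span {u, v})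
    (hm : ∀ z : R, maximalIdeal R ≠ Ideal.span {z}) {t t' : R}
    (ht : ¬ blowupRing R ((u + t * v : R) : K) ≤ R₁)
    (ht' : ¬ blowupRing R ((u + t' * v : R) : K) ≤ R₁) : t - t' ∈ maximalIdeal R := by
  have hdom := h.dominates
  have hRle : R ≤ R₁ := hdom.1
  -- `u + s v ≠ 0` for every `s`
  have hne : ∀ s : R, ((u + s * v : R) : K) ≠ 0 := by
    intro s e
    have e' : u + s * v = 0 := Subtype.ext e
    apply hm v
    rw [huv]
    refine le_antisymm ?_ (Ideal.span_mono (by simp))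
    rw [Ideal.span_le]
    rintro _ (rfl | rfl)
    · rw [SetLike.mem_coe, Ideal.mem_span_singleton']
      exact ⟨-s, by linear_combination -e'⟩
    · exact Ideal.subset_span rfl
  have hu_mem : u ∈ maximalIdeal R := huv ▸ Ideal.subset_span (by simp)
  have hv_mem : v ∈ maximalIdeal R := huv ▸ Ideal.subset_span (by simp)
  -- the key: in a chart containing `R₁`, a chart `u + sv` missing `R₁` gives a non-unit
  rcases h.blowupRing_le_or huv with hU | hV
  · -- chart of `u`: `e_s = (u + s v)/u ∈ R₁`, and `¬ R[𝔪/(u+sv)] ⊆ R₁ ⇒ e_s ∈ 𝔪_{R₁}`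
    have hu0 : ((u : R) : K) ≠ 0 := by
      intro e; apply hm v; rw [huv]
      have hu0' : u = 0 := Subtype.ext e
      rw [hu0', Ideal.span_insert, Ideal.span_singleton_eq_bot.mpr rfl, bot_sup_eq]
    have hvu : ((v : R) : K) / u ∈ R₁ := hU (div_mem_blowupRing _ hv_mem)
    have hes : ∀ s : R, ((u + s * v : R) : K) / u ∈ R₁ := fun s =>
      hU (div_mem_blowupRing _ (Ideal.add_mem _ hu_mem (Ideal.mul_mem_left _ _ hv_mem)))
    have hkey : ∀ s : R, ¬ blowupRing R ((u + s * v : R) : K) ≤ R₁ →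
        (⟨_, hes s⟩ : R₁) ∈ maximalIdeal R₁ := by
      intro s hs
      by_contra hunit
      rw [IsLocalRing.notMem_maximalIdeal, isUnit_subring_iff_inv_mem] at hunit
      obtain ⟨-, hinv⟩ := hunit
      change ((((u + s * v : R) : K)) / u)⁻¹ ∈ R₁ at hinv
      rw [inv_div] at hinv
      exact hs (blowupRing_le_of_div_mem hu0 hU hinv)
    have h1 := hkey t ht
    have h2 := hkey t' ht'
    -- `e_t = 1 + t (v/u)`, so `t (v/u)` and hence `v/u` is a unit of `R₁`
    have het : (⟨_, hes t⟩ : R₁) = 1 + Subring.inclusion hRle t * ⟨_, hvu⟩ := Subtype.ext (by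
      change ((u + t * v : R) : K) / u = 1 + (t : K) * ((v : K) / u)
      rw [Subring.coe_add, Subring.coe_mul]
      field_simp)
    have het' : (⟨_, hes t'⟩ : R₁) = 1 + Subring.inclusion hRle t' * ⟨_, hvu⟩ := Subtype.ext (by
      change ((u + t' * v : R) : K) / u = 1 + (t' : K) * ((v : K) / u)
      rw [Subring.coe_add, Subring.coe_mul]
      field_simp)
    have hunitTv : IsUnit (Subring.inclusion hRle t * ⟨_, hvu⟩) := by
      have h3 : Subring.inclusion hRle t * ⟨_, hvu⟩ = -(1 - (⟨_, hes t⟩ : R₁)) := by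
        rw [het]; ring
      rw [h3]
      exact (IsLocalRing.isUnit_one_sub_self_of_mem_nonunits _ h1).neg
    have hvunit : IsUnit (⟨_, hvu⟩ : R₁) := isUnit_of_mul_isUnit_right hunitTv
    -- the difference `(t − t') (v/u) ∈ 𝔪_{R₁}`
    have hdiff : Subring.inclusion hRle (t - t') * ⟨_, hvu⟩ ∈ maximalIdeal R₁ := by
      have e : Subring.inclusion hRle (t - t') * ⟨_, hvu⟩ = (⟨_, hes t⟩ : R₁) - ⟨_, hes t'⟩ := by
        rw [het, het', map_sub]; ring
      rw [e]; exact Ideal.sub_mem _ h1 h2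
    obtain ⟨w, hw⟩ := hvunit
    have hdiff' : Subring.inclusion hRle (t - t') ∈ maximalIdeal R₁ := by
      have e : Subring.inclusion hRle (t - t') =
          Subring.inclusion hRle (t - t') * ⟨_, hvu⟩ * ↑w⁻¹ := by
        rw [← hw, mul_assoc, Units.mul_inv, mul_one]
      rw [e]; exact Ideal.mul_mem_right _ _ hdiff
    exact (incl_mem_maximalIdeal_iff hdom _).mp hdiff'
  · -- chart of `v`: `e'_s = (u + s v)/v = u/v + s`
    have hv0 : ((v : R) : K) ≠ 0 := by
      intro e; apply hm u; rw [huv]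
      have hv0' : v = 0 := Subtype.ext e
      rw [hv0', Ideal.span_insert, Ideal.span_singleton_eq_bot.mpr rfl, sup_bot_eq]
    have huv' : ((u : R) : K) / v ∈ R₁ := hV (div_mem_blowupRing _ hu_mem)
    have hes : ∀ s : R, ((u + s * v : R) : K) / v ∈ R₁ := fun s =>
      hV (div_mem_blowupRing _ (Ideal.add_mem _ hu_mem (Ideal.mul_mem_left _ _ hv_mem)))
    have hkey : ∀ s : R, ¬ blowupRing R ((u + s * v : R) : K) ≤ R₁ →
        (⟨_, hes s⟩ : R₁) ∈ maximalIdeal R₁ := by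
      intro s hs
      by_contra hunit
      rw [IsLocalRing.notMem_maximalIdeal, isUnit_subring_iff_inv_mem] at hunit
      obtain ⟨-, hinv⟩ := hunit
      change ((((u + s * v : R) : K)) / v)⁻¹ ∈ R₁ at hinv
      rw [inv_div] at hinv
      exact hs (blowupRing_le_of_div_mem hv0 hV hinv)
    have h1 := hkey t ht
    have h2 := hkey t' ht'
    have het : (⟨_, hes t⟩ : R₁) = ⟨_, huv'⟩ + Subring.inclusion hRle t := Subtype.ext (by
      change ((u + t * v : R) : K) / v = (u : K) / v + (t : K)
      rw [Subring.coe_add, Subring.coe_mul]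
      field_simp)
    have het' : (⟨_, hes t'⟩ : R₁) = ⟨_, huv'⟩ + Subring.inclusion hRle t' := Subtype.ext (by
      change ((u + t' * v : R) : K) / v = (u : K) / v + (t' : K)
      rw [Subring.coe_add, Subring.coe_mul]
      field_simp)
    have hdiff : Subring.inclusion hRle (t - t') ∈ maximalIdeal R₁ := by
      have e : Subring.inclusion hRle (t - t') = (⟨_, hes t⟩ : R₁) - ⟨_, hes t'⟩ := by
        rw [het, het', map_sub]; ring
      rw [e]; exact Ideal.sub_mem _ h1 h2
    exact (incl_mem_maximalIdeal_iff hdom _).mp hdiff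

end Charts

/-! ## The dichotomy: valuation ring or again regular of dimension two -/

section Dichotomy

variable {R R₁ : Subring K}

/-- In a two-dimensional regular local ring with non-principal maximal ideal… precisely: **an
element `x ∈ 𝔪 ∖ 𝔪²` of a two-dimensional regular local ring is part of a regular system of
parameters** `𝔪 = (x, y)`, with `x` prime and `x ∤ y`. [cite: HunekeSwanson2006, §14.2 (p. 264)] -/
theorem exists_maximalIdeal_eq_span_pair_of_not_mem_sq [IsRegularLocalRing R]
    (hdim : ringKrullDim R = 2) {x : R} (hx : x ∈ maximalIdeal R) (hx2 : x ∉ maximalIdeal R ^ 2) :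
    ∃ y : R, maximalIdeal R = Ideal.span {x, y} ∧ Prime x ∧ ¬ x ∣ y := by
  have hfr : (maximalIdeal R).spanFinrank = 2 := by
    have := (isRegularLocalRing_iff R).mp ‹_›
    rw [hdim] at this
    exact_mod_cast this
  have hne1 := maximalIdeal_ne_span_singleton hdim
  obtain ⟨s, hsfin, hscard, hspan⟩ := exists_span_insert_eq_maximalIdeal hx hx2
  rw [hfr] at hscard
  have hs1 : s.ncard = 1 := by
    rcases Nat.lt_or_ge s.ncard 1 with h | h
    · exfalso
      have hs0 : s = ∅ := (Set.ncard_eq_zero hsfin).mp (by omega)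
      rw [hs0, ← Set.singleton_def] at hspan
      exact hne1 x hspan.symm
    · omega
  obtain ⟨y, rfl⟩ := Set.ncard_eq_one.mp hs1
  have hm : maximalIdeal R = Ideal.span {x, y} := hspan.symm
  have hxy : ¬ x ∣ y := by
    intro hdvd
    apply hne1 x
    rw [hm]
    apply le_antisymm
    · rw [Ideal.span_le]
      rintro _ (rfl | rfl)
      · exact Ideal.mem_span_singleton_self _
      · exact Ideal.mem_span_singleton.mpr hdvd
    · exact Ideal.span_mono (Set.singleton_subset_iff.mpr (Set.mem_insert _ _))
  exact ⟨y, hm, IsRegularLocalRing.prime_of_not_mem_sq hx hx2, hxy⟩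

/-- **Dichotomy for a quadratic transform of a two-dimensional regular local ring** `R` of `K`
(Huneke–Swanson, proof of Thm. 14.5.2, p. 276: "`R₁ = (R[𝔪₀/x₀])_{𝔪₁}` … If `𝔪₁` has height 1,
then `R₁` is a Noetherian discrete valuation ring … So necessarily `R₁` is again a
two-dimensional regular local ring"): with `𝔪_R = (x, y)`, `A = R[y/x]` and `R₁ = A_Q`, either
`Q` is the exceptional prime `xA` and `R₁` is a valuation ring of `K`, or `xA ⊊ Q = (x, f)` and
`R₁` is a two-dimensional regular local ring. [cite: HunekeSwanson2006, Thm. 14.5.2 (proof)] -/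
theorem IsQuadraticTransform.mem_or_inv_mem_or_isRegularLocalRing [IsRegularLocalRing R]
    (hdim : ringKrullDim R = 2) (hRK : IsLocalRingOf R) (h : IsQuadraticTransform R R₁) :
    (∀ z : K, z ∈ R₁ ∨ z⁻¹ ∈ R₁) ∨ (IsRegularLocalRing R₁ ∧ ringKrullDim R₁ = 2) := by
  haveI := h.isLocalRing
  obtain ⟨_, x, hxm, hx0, _, hT, hfrac, hdom⟩ := id h
  have hx2 : x ∉ maximalIdeal R ^ 2 := IsQuadraticTransform.chart_not_mem_sq hT hdom hx0
  obtain ⟨y, hm, hxp, hxy⟩ := exists_maximalIdeal_eq_span_pair_of_not_mem_sq hdim hxm hx2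
  have hpq : ∀ t, x ∣ y * t → x ∣ t := fun t ht => (hxp.dvd_or_dvd ht).resolve_left hxy
  have hym : y ∈ maximalIdeal R := hm ▸ Ideal.subset_span (by simp)
  have hx0K : ((x : R) : K) ≠ 0 := fun e => hx0 (Subtype.ext e)
  -- the chart `A = R[y/x] = R[𝔪/x]` and the presentation `R₁ = A_Q`
  set u : K := ((y : R) : K) / ((x : R) : K) with hu
  set A : Subring K := (Algebra.adjoin R {u}).toSubring with hAdef
  have hA : blowupRing R (x : K) = A := blowupRing_eq_adjoin hm
  have hAle : A ≤ R₁ := hA ▸ hT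
  set Q : Ideal A := (maximalIdeal R₁).comap (Subring.inclusion hAle) with hQdef
  have hR₁ : R₁ = (LocalSubring.ofPrime A Q).toSubring :=
    h.eq_ofPrime_of_le hxm hx0 hA.le hAle
  have hAK : ∀ z : K, ∃ a ∈ A, ∃ b ∈ A, b ≠ 0 ∧ z = a / b := by
    intro z
    obtain ⟨a, ha, b, hb, hb0, rfl⟩ := hRK.2 z
    exact ⟨a, subring_le_adjoin R u ha, b, subring_le_adjoin R u hb, hb0, rfl⟩
  haveI : IsNoetherianRing A := isNoetherianRing_adjoin_toSubring R u
  -- the exceptional prime `𝔭 = 𝔪_R A = xA ≤ Q`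
  set ιA := Subring.inclusion (subring_le_adjoin R u) with hιA
  set 𝔭 : Ideal A := (maximalIdeal R).map ιA with h𝔭def
  haveI h𝔭 : 𝔭.IsPrime := isPrime_map_incl (K := K) hx0 hpq hxm hym
  have h𝔭eq : 𝔭 = Ideal.span {ιA x} := by
    rw [h𝔭def, hm]; exact map_incl_span_pair hx0 y
  have h𝔭Q : 𝔭 ≤ Q := by
    rw [h𝔭def, Ideal.map_le_iff_le_comap]
    intro r hr
    rw [Ideal.mem_comap, hQdef, Ideal.mem_comap]
    exact (incl_mem_maximalIdeal_iff hdom r).mpr hr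
  by_cases h𝔭Q' : 𝔭 = Q
  · -- `Q = xA`: `R₁ = A_{(x)}` is a valuation ring of `K`
    left
    have hQeq : Q = Ideal.span {ιA x} := h𝔭Q' ▸ h𝔭eq
    intro z
    have := mem_or_inv_mem_ofPrime_of_span_singleton hQeq hAK z
    rwa [← hR₁] at this
  · -- `xA ⊊ Q`: `R₁` is regular of dimension two
    right
    have h𝔭lt : 𝔭 < Q := lt_of_le_of_ne h𝔭Q h𝔭Q'
    have hbot : (⊥ : Ideal A) < 𝔭 := by
      rw [bot_lt_iff_ne_bot, h𝔭eq, Ne, Ideal.span_singleton_eq_bot]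
      intro h0
      exact hx0K (congrArg (fun s : A => (s : K)) h0)
    have hheight : (2 : ℕ∞) ≤ Q.height := by
      have h1 := Ideal.height_add_one_le_of_lt_of_isPrime hbot
      have h2 := Ideal.height_add_one_le_of_lt_of_isPrime h𝔭lt
      rw [Ideal.height_bot, zero_add] at h1
      calc (2 : ℕ∞) = 1 + 1 := by norm_num
        _ ≤ 𝔭.height + 1 := by gcongr
        _ ≤ Q.height := h2
    -- transport to the subring `L = A_Q = R₁`
    set L := (LocalSubring.ofPrime A Q).toSubring with hL
    haveI : IsNoetherianRing L := isNoetherianRing_ofPrime (A := A) (P := Q)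
    have hdimge : (2 : WithBot ℕ∞) ≤ ringKrullDim L := by
      rw [IsLocalization.AtPrime.ringKrullDim_eq_height Q L]
      exact WithBot.coe_le_coe.mpr hheight
    obtain ⟨f, hQf⟩ := exists_eq_span_pair_of_map_maximalIdeal_le hm hx0 rfl h𝔭Q
    have hmax : maximalIdeal L = Ideal.span {algebraMap A L (ιA x), algebraMap A L f} := by
      have e : Q.map (algebraMap A L) = (Ideal.span {ιA x, f}).map (algebraMap A L) :=
        congrArg (Ideal.map (algebraMap A L)) hQf
      rw [← IsLocalization.AtPrime.map_eq_maximalIdeal Q L, e, Ideal.map_span,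
        Set.image_insert_eq, Set.image_singleton]
    have hfr : (maximalIdeal L).spanFinrank ≤ 2 := by
      rw [hmax]
      refine (Submodule.spanFinrank_span_le_ncard_of_finite (Set.toFinite _)).trans ?_
      exact (Set.ncard_insert_le _ _).trans (by rw [Set.ncard_singleton])
    have hreg : IsRegularLocalRing L :=
      IsRegularLocalRing.of_spanFinrank_maximalIdeal_le _
        (le_trans (by exact_mod_cast hfr) hdimge)
    have hdim₁ : ringKrullDim L = 2 := by
      refine le_antisymm ?_ hdimge
      rw [← hreg.spanFinrank_maximalIdeal]
      exact_mod_cast hfr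
    rw [hR₁]
    exact ⟨hreg, hdim₁⟩

/-- **A quadratic transform of a two-dimensional regular local ring of `K` which is not a
valuation ring of `K` is again a two-dimensional regular local ring** (the valuation alternative
of the dichotomy being excluded). [cite: HunekeSwanson2006, Thm. 14.5.2 (proof)] -/
theorem IsQuadraticTransform.isRegularLocalRing_of_not_forall_mem_or_inv_mem [IsRegularLocalRing R]
    (hdim : ringKrullDim R = 2) (hRK : IsLocalRingOf R) (h : IsQuadraticTransform R R₁)
    (hnot : ¬ ∀ z : K, z ∈ R₁ ∨ z⁻¹ ∈ R₁) : IsRegularLocalRing R₁ ∧ ringKrullDim R₁ = 2 :=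
  (h.mem_or_inv_mem_or_isRegularLocalRing hdim hRK).resolve_left hnot

end Dichotomy

end Literature.AlgebraicGeometry.Resolution

end
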